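import Literature.AnabelianGeometry.AbsoluteAnabelian.MonoidKummerMapsIdRigidTFProofs
import Literature.AnabelianGeometry.AbsoluteAnabelian.MLFGaloisIntrinsic
import Literature.AnabelianGeometry.AbsoluteAnabelian.MonoidKummerMapsProofs
import Literature.AnabelianGeometry.AbsoluteAnabelian.MLFGaloisModelPairs

/-!
# [AbsTopIII] Prop 3.2 (iv), injectivity for `T = TF` — DISCHARGED: an isomorphism of MLF-Galois `TF`-pairs
# is determined by its Galois component (proof-only; abc-iut cell, sub-DAG [AbsTopIII] Prop 3.2 (i)(iv),
# row P32.iv.L13-TF; hence rows L14-TF / L17-TF hold modulo slimness alone)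

S. Mochizuki, *Topics in Absolute Anabelian Geometry III*, §3, Prop. 3.2 (iv) p. 72 («the natural functor of
Definition 3.1, (iii), induces an injection `Isom_{𝒞^MLF_T}((Π ↷ M_T), (Π* ↷ M*_T)) ↪ Isom_{𝒯𝒢}(Π, Π*)`»,
`T ∈ {TM, TF}`; proof p. 72 l.45–47 «automorphisms … that act trivially on `Π` necessarily act trivially on
`M_TM`»), bib key `MochizukiAbsTopIII2015`.  The `TM` case is abc-iut-L6-t13's `pairIsoDeterminedByGalois_holds`;
this file proves the `TF` case `fieldPairIsoDeterminedByGalois_holds : FieldPairIsoDeterminedByGalois`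
(typed in `MonoidKummerMapsSub.lean` v2) by the printed route through Def. 3.1 (iii):

1. `ModelMLFGaloisData.fieldPairIso_isoM_apply_eq_self` — an automorphism `(id_Π, σ)` of the model `TF`-pair
   `(Π_k ↷ k̄)` has `σ = id`: `σ` transports abc-iut-L4-t2's INTRINSIC non-zero integers
   (`GaloisFieldPair.isIntrinsicInteger_iff_of_iso`), which on the model are `𝒪_k̄^⊳`
   (`ne_zero_and_isIntrinsicInteger_fieldPair_iff`, `MLFGaloisIntrinsic.lean`), so `σ(𝒪^⊳) = 𝒪^⊳` and
   `(id_Π, σ|_{𝒪^⊳})` is an automorphism of the model `TM`-pair over `id_Π`, hence trivial on `𝒪^⊳` by the `TM`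
   case; and a ring automorphism of `k̄` fixing `𝒪_k̄^⊳` pointwise is the identity
   (`MLFClosure.ringEquiv_apply_eq_self_of_forall_nonzeroIntegers`: clear denominators with `𝒪_k ∖ {0}`).
2. `fieldPairIsoDeterminedByGalois_holds` — transport to a model along Def. 3.1 (ii).
3. COROLLARIES `autFieldPairCenterFree_of_isSlimGroup'`, `prop32iv_idRigidTF_of_isSlimGroup'` — rows L14-TF /
   L17-TF of the sub-DAG now hold modulo the slimness of `Π` ALONE (the printed input [Mzk20] Prop. 2.3 (ii)).

HONEST FRAMING: OUR kernel check of a statement of a refereed paper over OUR model of Def. 3.1; nothing here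
bears on [IUTchIII] Cor. 3.12, and nothing here asserts that abc is proved or refuted.
-/

namespace Literature.AnabelianGeometry.AbsoluteAnabelian

open _root_.ValuativeRel

noncomputable section

/-! ### 1. The model case -/

/-- A ring automorphism of `k̄` fixing `𝒪_k̄^⊳` pointwise is the identity (every `x ∈ k̄` becomes a non-zero
integer after multiplication by a non-zero element of `𝒪_k`, itself a fixed non-zero integer).
[cite: MochizukiAbsTopIII2015, Definition 3.1 (i) p.66] -/
theorem MLFClosure.ringEquiv_apply_eq_self_of_forall_nonzeroIntegers (C : MLFClosure.{0}) (σ : C.K ≃+* C.K)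
    (h : ∀ x : C.K, x ∈ nonzeroIntegers C.k C.K → σ x = x) (x : C.K) : σ x = x := by
  by_cases hx : x = 0
  · simp [hx]
  have halg : IsAlgebraic C.k x := Algebra.IsAlgebraic.isAlgebraic x
  have halg' : IsAlgebraic 𝒪[C.k] x := (IsFractionRing.isAlgebraic_iff 𝒪[C.k] C.k C.K).mpr halg
  obtain ⟨y, hy0, hint⟩ := halg'.exists_integral_multiple
  have halgmap : algebraMap 𝒪[C.k] C.K y = algebraMap C.k C.K (y : C.k) := rfl
  have hy0' : algebraMap C.k C.K (y : C.k) ≠ 0 := (map_ne_zero _).mpr (by exact_mod_cast hy0)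
  have hyK : algebraMap C.k C.K (y : C.k) ∈ nonzeroIntegers C.k C.K := by
    refine ⟨(mem_integralClosure_iff _ _).mpr ?_, hy0'⟩
    rw [← halgmap]
    exact isIntegral_algebraMap
  have hyx : (y • x) ∈ nonzeroIntegers C.k C.K := by
    refine ⟨(mem_integralClosure_iff _ _).mpr hint, ?_⟩
    rw [Algebra.smul_def, halgmap]
    exact mul_ne_zero hy0' hx
  have h1 := h _ hyx
  rw [Algebra.smul_def, halgmap, map_mul, h _ hyK] at h1
  exact mul_left_cancel₀ hy0' h1

/-- **Prop 3.2 (iv) injectivity, `T = TF`, model form**: an automorphism of the model `TF`-pair `(Π_k ↷ k̄)`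
whose Galois component is the identity is the identity on `k̄` — via Def 3.1 (iii): it preserves the intrinsic
`𝒪_k̄^⊳` (abc-iut-L4-t2), restricts to an automorphism of the model `TM`-pair over `id_Π`, which is trivial by
the `TM` case (abc-iut-L6-t13's `pairIsoDeterminedByGalois_holds`), and `k̄` is generated by `𝒪_k̄^⊳` over the
non-zero elements of `𝒪_k`. [cite: MochizukiAbsTopIII2015, Proposition 3.2 (iv) p.72] -/
theorem ModelMLFGaloisData.fieldPairIso_isoM_apply_eq_self (C : MLFClosure.{0})
    (D : ModelMLFGaloisData C.k C.K) (e : GaloisFieldPair.Iso D.fieldPair D.fieldPair)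
    (he : ∀ g, e.isoPi g = g) (x : C.K) : e.isoM x = x := by
  -- the field component, viewed as a ring automorphism `σ` of `k̄`, equivariant along `e_Π` through `ε_k`
  set σ : C.K ≃+* C.K := e.isoM with hσ
  have hsmul : ∀ (g : D.Pi) (y : C.K), σ (D.aug g • y) = D.aug (e.isoPi g) • σ y := fun g y =>
    e.smul_comm g y
  -- `σ` preserves `𝒪^⊳`: intrinsic non-zero integers are transported by isomorphisms of pairs
  have hpres : ∀ y : C.K, y ∈ nonzeroIntegers C.k C.K ↔ σ y ∈ nonzeroIntegers C.k C.K := by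
    intro y
    have h1 := D.ne_zero_and_isIntrinsicInteger_fieldPair_iff C y
    have h2 := D.ne_zero_and_isIntrinsicInteger_fieldPair_iff C (σ y)
    have h3 : D.fieldPair.IsIntrinsicInteger y ↔ D.fieldPair.IsIntrinsicInteger (σ y) :=
      GaloisFieldPair.isIntrinsicInteger_iff_of_iso e y
    have h4 : y ≠ 0 ↔ σ y ≠ 0 := σ.map_ne_zero_iff.symm
    exact h1.symm.trans ((and_congr h4 h3).trans h2)
  -- the restriction of `σ` to `𝒪^⊳`
  let γ : ↥(nonzeroIntegers C.k C.K) ≃* ↥(nonzeroIntegers C.k C.K) :=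
    { toFun := fun y => ⟨σ y, (hpres y).mp y.2⟩
      invFun := fun y => ⟨σ.symm y, by
        have h := hpres (σ.symm y)
        rw [RingEquiv.apply_symm_apply] at h
        exact h.mpr y.2⟩
      left_inv := fun y => Subtype.ext (σ.symm_apply_apply (y : C.K))
      right_inv := fun y => Subtype.ext (σ.apply_symm_apply (y : C.K))
      map_mul' := fun y z => Subtype.ext (by
        show σ ((y : C.K) * (z : C.K)) = σ y * σ z
        exact map_mul σ _ _) }
  -- … is the monoid component of an automorphism of the model `TM`-pair over `e_Π`
  let eTM : GaloisMonoidPair.Iso D.tmPair D.tmPair :=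
    { isoPi := e.isoPi
      isoM := γ
      smul_comm := fun g y => Subtype.ext (by
        show σ (D.aug g • (y : C.K)) = D.aug (e.isoPi g) • σ y
        exact hsmul g y) }
  have hPi : eTM.isoPi = (GaloisMonoidPair.Iso.refl D.tmPair).isoPi := by
    ext g
    exact he g
  -- the `TM` case: `eTM` has the monoid component of the identity
  have hM : eTM.isoM = (GaloisMonoidPair.Iso.refl D.tmPair).isoM :=
    pairIsoDeterminedByGalois_holds D.tmPair D.tmPair (isMLFGaloisMonoidPair_tmPair C D)
      (isMLFGaloisMonoidPair_tmPair C D) eTM _ hPi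
  have hfix : ∀ y : C.K, y ∈ nonzeroIntegers C.k C.K → σ y = y := fun y hy => by
    have h := congrArg
      (fun f : ↥(nonzeroIntegers C.k C.K) ≃* ↥(nonzeroIntegers C.k C.K) => ((f ⟨y, hy⟩ : _) : C.K)) hM
    exact h
  exact C.ringEquiv_apply_eq_self_of_forall_nonzeroIntegers σ hfix x

/-! ### 2. The typed schema, discharged -/

/-- **Prop 3.2 (iv), injectivity for `T = TF` — PROVED**: an isomorphism of MLF-Galois `TF`-pairs is
determined by its Galois component (`FieldPairIsoDeterminedByGalois`, `MonoidKummerMapsSub.lean` v2): transport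
`e₂⁻¹ ∘ e₁` to a model along Def 3.1 (ii) and apply the model form.
[cite: MochizukiAbsTopIII2015, Proposition 3.2 (iv) p.72] -/
theorem fieldPairIsoDeterminedByGalois_holds : FieldPairIsoDeterminedByGalois := by
  intro P Q hP _ e₁ e₂ h12
  obtain ⟨C, D, ⟨ι⟩⟩ := hP.exists_model
  -- the automorphism `ι ; e₁ ; e₂⁻¹ ; ι⁻¹` of the model pair lies over the identity of `Π_k`
  let τ : GaloisFieldPair.Iso D.fieldPair D.fieldPair := (ι.trans' (e₁.trans' e₂.symm')).trans' ι.symm'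
  have hτ : ∀ g, τ.isoPi g = g := fun g => by
    simp only [τ, GaloisFieldPair.Iso.trans'_isoPi_apply, GaloisFieldPair.Iso.symm'_isoPi_apply, h12,
      ContinuousMulEquiv.symm_apply_apply]
  apply RingEquiv.ext
  intro x
  have hx := D.fieldPairIso_isoM_apply_eq_self C τ hτ (ι.isoM.symm x)
  simp only [τ, GaloisFieldPair.Iso.trans'_isoM_apply, GaloisFieldPair.Iso.symm'_isoM_apply,
    RingEquiv.apply_symm_apply] at hx
  have h2 : e₂.isoM.symm (e₁.isoM x) = x := ι.isoM.symm.injective hx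
  calc e₁.isoM x = e₂.isoM (e₂.isoM.symm (e₁.isoM x)) := (e₂.isoM.apply_symm_apply _).symm
    _ = e₂.isoM x := by rw [h2]

/-! ### 3. Rows L14-TF / L17-TF modulo slimness alone -/

/-- **Row P32.iv.L14 for `T = TF`, modulo slimness alone**: if `H` forces `Π` to be slim, then
`AutFieldPairCenterFree H` («the center-free-ness … follows immediately from the slimness of `Π`», the
injectivity input now discharged). [cite: MochizukiAbsTopIII2015, Proposition 3.2 (iv) p.72] -/
theorem autFieldPairCenterFree_of_isSlimGroup' {H : GaloisFieldPair.{0} → Prop}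
    (hslim : ∀ P : GaloisFieldPair.{0}, IsMLFGaloisFieldPair P → H P →
      Literature.AlgebraicGeometry.Frobenioids.IsSlimGroup P.Pi) :
    AutFieldPairCenterFree H :=
  autFieldPairCenterFree_of_isSlimGroup fieldPairIsoDeterminedByGalois_holds hslim

/-- **Row P32.iv.L17 for `T = TF`, modulo slimness alone**: if `H` forces `Π` to be slim, the full subcategory
`𝒞^{MLF-H}_TF` is id-rigid («the categories … `𝒞^{MLF-hyp}_T`, `𝒞^{MLF-sB}_T` … are id-rigid [cf. §0]» at
`T = TF`). [cite: MochizukiAbsTopIII2015, Proposition 3.2 (iv) p.72] -/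
theorem prop32iv_idRigidTF_of_isSlimGroup' {H : GaloisFieldPair.{0} → Prop}
    (hslim : ∀ P : GaloisFieldPair.{0}, IsMLFGaloisFieldPair P → H P →
      Literature.AlgebraicGeometry.Frobenioids.IsSlimGroup P.Pi) :
    Prop32iv_idRigidTF.{0} H :=
  prop32iv_idRigidTF_of_isSlimGroup fieldPairIsoDeterminedByGalois_holds hslim

end

end Literature.AnabelianGeometry.AbsoluteAnabelian
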